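import Mathlib
import HarnessLib

/-!
# LatticeQCDFlow / Scaling — composing positive kernels through an integrated variable preserves
# STRICT total positivity of order two (Karlin's basic composition formula, `2 × 2` case), so a
# bond reached THROUGH the integrated block is still not of product form

HONEST FRAMING: exact (Metropolis-corrected) sampling algorithms for lattice gauge theory;
figures of merit are autocorrelation/cost numbers at stated couplings and volumes; no
continuum-physics claim.

Venture `LatticeQCDFlow` (cell pub-lqcd), topic `Scaling`, FANOUT row 30 (lean-1, GEN-17) — OUR WORK
toward THEORY-2.md §4 conjecture C5 (faithfulness of the exact autoregressive context) THROUGH THE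
INTEGRATED BLOCK.  GEN-16 (`Scaling/AutoregressiveBondFaithful`): if the exact conditional of the
current variable `a` is blind to a retained variable `j`, the DIRECT two-body factor between them is of
product form.  When `j` is reached from `a` through integrated variables `x₁, …, x_k`, the factor the
conditional sees is the COMPOSED kernel `K(u,t) = ∫⋯∫ b₀(u,x₁) g₁(x₁) b₁(x₁,x₂) ⋯ g_k(x_k) b_k(x_k,t) dμ^k`
(sequel `Scaling/AutoregressivePathFaithful`).  Kernel-level analysis, any measurable space `X` with a
linear order (`ℝ`, `[-1, 1]`, …), any reference measure `μ`:

* §1 `compKernel μ F g B (u,t) = ∫ F(u,x) g(x) B(x,t) dμ(x)`; **`compKernel_minor_eq`** — Karlin's basic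
  composition formula for `2 × 2` minors,
  `K(u,t)K(u',t') − K(u,t')K(u',t) = ½ ∫∫ [F(u,x)F(u',y) − F(u,y)F(u',x)]·g(x)g(y)·[B(x,t)B(y,t') − B(x,t')B(y,t)]`;
* §2 **`compKernel_tp2`** — `F`, `B` totally positive of order two (`F(u,y)F(u',x) ≤ F(u,x)F(u',y)` for
  `u < u'`, `x < y`), `g ≥ 0` ⇒ `K` is TP₂ (both brackets change sign together);
* §3 **`compKernel_stp2`** — `F`, `B` STRICTLY TP₂, `g > 0`, and the reference measure sees two
  comparable points (`0 < (μ ⊗ μ){x < y}`: `μ` is not a point mass; `prod_lt_pos_of_separated`) ⇒ `K`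
  strictly TP₂; **`compKernel_not_productForm`** — a composed genuine bond is a genuine bond;
* §4 `pathKernel μ F [(g₁,b₁), …, (g_k,b_k)]` (iterated composition) and **`pathKernel_stp2`** /
  **`pathKernel_not_productForm`**: along any finite path of strictly TP₂ positive bounded measurable
  bonds with positive bounded measurable site weights the composed kernel is strictly TP₂ (positivity,
  bounds, joint measurability carried through the induction);
* §5 flipping a bond keeps strict TP₂; a reference measure on `ℝ` charging `(−∞,c)` and `(c,∞)` sees
  two comparable points (the Gaussian / gradient-`φ⁴` bond is treated in the sequel).

READING (value-free, C5): total positivity carries faithfulness through marginalisation in one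
dimension (every ferromagnetic nearest-neighbour pair interaction, arbitrary one-body terms); the
lattice statements (ring; paths through the block) are the sequel.  NOT CLAIMED: multivariate total
positivity (MTP₂, Karlin–Rinott 1980) and its preservation under marginals — what `d ≥ 2` needs;
kernels on spaces without an order (gauge groups, where GEN-15/16 show the symbolic context is NOT
attained).  Literature grade (cell rule): known mechanism (Karlin, Total Positivity (1968) Ch. 3;
Karlin–Taylor, A Second Course in Stochastic Processes; Pinkus 1985 p. 96); typed statements ours.
`def compKernel`, `def pathKernel`; nothing is cited as a fact; no `sorry`.
-/

noncomputable section

namespace Summit.Ventures.LatticeQCDFlow.Theory2.Autoregressive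

open MeasureTheory Function Set

variable {X : Type*} [MeasurableSpace X]

/-! ## §1 The composed kernel and the basic composition formula (`2 × 2`) -/

/-- **The composed kernel** through one integrated intermediate variable with site weight `g`:
`compKernel μ F g B u t = ∫ F(u, x) · g(x) · B(x, t) dμ(x)`. [ours] -/
def compKernel (μ : Measure X) (F : X → X → ℝ) (g : X → ℝ) (B : X → X → ℝ) : X → X → ℝ :=
  fun u t => ∫ x, F u x * g x * B x t ∂μ

variable (μ : Measure X)

/-- Unfolding `compKernel`. [ours] -/
theorem compKernel_apply (F : X → X → ℝ) (g : X → ℝ) (B : X → X → ℝ) (u t : X) :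
    compKernel μ F g B u t = ∫ x, F u x * g x * B x t ∂μ := rfl
/-- **KARLIN'S BASIC COMPOSITION FORMULA, `2 × 2` CASE.**  For `K = compKernel μ F g B` with the four
sections `x ↦ F(v,x) g(x) B(x,r)` (`v ∈ {u,u'}`, `r ∈ {t,t'}`) integrable:
`K(u,t)K(u',t') − K(u,t')K(u',t) = ½ ∫ [F(u,x)F(u',y) − F(u,y)F(u',x)]·(g x g y)·[B(x,t)B(y,t') − B(x,t')B(y,t)] d(μ⊗μ)(x,y)`.
[folklore: Karlin 1968 Ch. 3; typed here] -/
theorem compKernel_minor_eq [SFinite μ] (F : X → X → ℝ) (g : X → ℝ) (B : X → X → ℝ)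
    (u u' t t' : X) (hint : ∀ v r, Integrable (fun x => F v x * g x * B x r) μ) :
    compKernel μ F g B u t * compKernel μ F g B u' t' -
        compKernel μ F g B u t' * compKernel μ F g B u' t =
      (1 / 2) * ∫ p : X × X, (F u p.1 * F u' p.2 - F u p.2 * F u' p.1) * (g p.1 * g p.2) *
        (B p.1 t * B p.2 t' - B p.1 t' * B p.2 t) ∂(μ.prod μ) := by
  -- the two products of integrals as integrals over `μ ⊗ μ`
  let Φ : X × X → ℝ := fun p =>
    (F u p.1 * g p.1 * B p.1 t) * (F u' p.2 * g p.2 * B p.2 t') -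
      (F u p.1 * g p.1 * B p.1 t') * (F u' p.2 * g p.2 * B p.2 t)
  have hΦi : Integrable Φ (μ.prod μ) :=
    ((hint u t).mul_prod (hint u' t')).sub ((hint u t').mul_prod (hint u' t))
  have e1 : (∫ x, F u x * g x * B x t ∂μ) * (∫ x, F u' x * g x * B x t' ∂μ) =
      ∫ p : X × X, (F u p.1 * g p.1 * B p.1 t) * (F u' p.2 * g p.2 * B p.2 t') ∂(μ.prod μ) :=
    (integral_prod_mul (μ := μ) (ν := μ) (fun x => F u x * g x * B x t)
      (fun y => F u' y * g y * B y t')).symm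
  have e2 : (∫ x, F u x * g x * B x t' ∂μ) * (∫ x, F u' x * g x * B x t ∂μ) =
      ∫ p : X × X, (F u p.1 * g p.1 * B p.1 t') * (F u' p.2 * g p.2 * B p.2 t) ∂(μ.prod μ) :=
    (integral_prod_mul (μ := μ) (ν := μ) (fun x => F u x * g x * B x t')
      (fun y => F u' y * g y * B y t)).symm
  have hD : compKernel μ F g B u t * compKernel μ F g B u' t' -
      compKernel μ F g B u t' * compKernel μ F g B u' t = ∫ p, Φ p ∂(μ.prod μ) := by
    simp only [compKernel_apply]
    rw [e1, e2, ← integral_sub ((hint u t).mul_prod (hint u' t')) ((hint u t').mul_prod (hint u' t))]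
  -- symmetrise: `∫ Φ = ∫ Φ ∘ swap`
  have hswap : ∫ p, Φ p ∂(μ.prod μ) = ∫ p, Φ p.swap ∂(μ.prod μ) :=
    (integral_prod_swap Φ).symm
  have hΦsi : Integrable (fun p : X × X => Φ p.swap) (μ.prod μ) := hΦi.swap
  have h2 : 2 * ∫ p, Φ p ∂(μ.prod μ) = ∫ p, (Φ p + Φ p.swap) ∂(μ.prod μ) := by
    rw [integral_add hΦi hΦsi, ← hswap, two_mul]
  have hpt : ∀ p : X × X, Φ p + Φ p.swap =
      (F u p.1 * F u' p.2 - F u p.2 * F u' p.1) * (g p.1 * g p.2) *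
        (B p.1 t * B p.2 t' - B p.1 t' * B p.2 t) := by
    intro p; simp only [Φ, Prod.fst_swap, Prod.snd_swap]; ring
  rw [hD]
  have : ∫ p, Φ p ∂(μ.prod μ) = (1 / 2) * ∫ p, (Φ p + Φ p.swap) ∂(μ.prod μ) := by
    rw [← h2]; ring
  rw [this]
  congr 1
  exact integral_congr_ae (ae_of_all _ fun p => hpt p)

/-- The symmetrised integrand of `compKernel_minor_eq` is integrable on `μ ⊗ μ` as soon as the four
sections are (it is `Φ + Φ ∘ swap` for an integrable `Φ`). [ours] -/
theorem integrable_minor_integrand [SFinite μ] (F : X → X → ℝ) (g : X → ℝ) (B : X → X → ℝ)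
    (u u' t t' : X) (hint : ∀ v r, Integrable (fun x => F v x * g x * B x r) μ) :
    Integrable (fun p : X × X => (F u p.1 * F u' p.2 - F u p.2 * F u' p.1) * (g p.1 * g p.2) *
      (B p.1 t * B p.2 t' - B p.1 t' * B p.2 t)) (μ.prod μ) := by
  let Φ : X × X → ℝ := fun p =>
    (F u p.1 * g p.1 * B p.1 t) * (F u' p.2 * g p.2 * B p.2 t') -
      (F u p.1 * g p.1 * B p.1 t') * (F u' p.2 * g p.2 * B p.2 t)
  have hΦi : Integrable Φ (μ.prod μ) :=
    ((hint u t).mul_prod (hint u' t')).sub ((hint u t').mul_prod (hint u' t))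
  have heq : (fun p : X × X => (F u p.1 * F u' p.2 - F u p.2 * F u' p.1) * (g p.1 * g p.2) *
      (B p.1 t * B p.2 t' - B p.1 t' * B p.2 t)) = fun p => Φ p + Φ p.swap := by
    funext p; simp only [Φ, Prod.fst_swap, Prod.snd_swap]; ring
  rw [heq]
  exact hΦi.add hΦi.swap

/-! ## §2 TP₂ composed with TP₂ is TP₂ -/

section Order

variable [LinearOrder X]

omit [MeasurableSpace X] in
/-- Pointwise sign of the composition integrand: if `F` and `B` are TP₂ and `g ≥ 0`, then for
`u < u'`, `t < t'` and EVERY pair `(x, y)` the integrand of `compKernel_minor_eq` is `≥ 0` (for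
`x < y` both brackets are `≥ 0`, for `y < x` both are `≤ 0`, for `x = y` the first vanishes). [ours] -/
theorem minor_integrand_nonneg {F B : X → X → ℝ} {g : X → ℝ}
    (hF : ∀ u u' x y, u < u' → x < y → F u y * F u' x ≤ F u x * F u' y)
    (hB : ∀ x y t t', x < y → t < t' → B x t' * B y t ≤ B x t * B y t')
    (hg : ∀ x, 0 ≤ g x) {u u' t t' : X} (hu : u < u') (ht : t < t') (p : X × X) :
    0 ≤ (F u p.1 * F u' p.2 - F u p.2 * F u' p.1) * (g p.1 * g p.2) *
      (B p.1 t * B p.2 t' - B p.1 t' * B p.2 t) := by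
  have hgg : 0 ≤ g p.1 * g p.2 := mul_nonneg (hg _) (hg _)
  rcases lt_trichotomy p.1 p.2 with h | h | h
  · exact mul_nonneg (mul_nonneg (sub_nonneg.2 (hF u u' p.1 p.2 hu h)) hgg)
      (sub_nonneg.2 (hB p.1 p.2 t t' h ht))
  · rw [h]; simp
  · have h1 : F u p.1 * F u' p.2 - F u p.2 * F u' p.1 ≤ 0 := by
      have := hF u u' p.2 p.1 hu h; linarith
    have h3 : B p.1 t * B p.2 t' - B p.1 t' * B p.2 t ≤ 0 := by
      have := hB p.2 p.1 t t' h ht; linarith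
    have := mul_nonneg_of_nonpos_of_nonpos (mul_nonpos_of_nonpos_of_nonneg h1 hgg) h3
    simpa [mul_comm, mul_assoc, mul_left_comm] using this

/-- **TP₂ ∘ TP₂ IS TP₂.**  If `F` and `B` are totally positive of order two, `g ≥ 0`, and the sections
are integrable, then `K = compKernel μ F g B` is totally positive of order two:
`K(u,t')K(u',t) ≤ K(u,t)K(u',t')` for `u < u'`, `t < t'`. [folklore: Karlin; typed here] -/
theorem compKernel_tp2 [SFinite μ] {F B : X → X → ℝ} {g : X → ℝ}
    (hF : ∀ u u' x y, u < u' → x < y → F u y * F u' x ≤ F u x * F u' y)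
    (hB : ∀ x y t t', x < y → t < t' → B x t' * B y t ≤ B x t * B y t')
    (hg : ∀ x, 0 ≤ g x) (hint : ∀ v r, Integrable (fun x => F v x * g x * B x r) μ)
    {u u' t t' : X} (hu : u < u') (ht : t < t') :
    compKernel μ F g B u t' * compKernel μ F g B u' t ≤
      compKernel μ F g B u t * compKernel μ F g B u' t' := by
  have h := compKernel_minor_eq μ F g B u u' t t' hint
  have hnn : 0 ≤ ∫ p : X × X, (F u p.1 * F u' p.2 - F u p.2 * F u' p.1) * (g p.1 * g p.2) *
      (B p.1 t * B p.2 t' - B p.1 t' * B p.2 t) ∂(μ.prod μ) :=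
    integral_nonneg fun p => minor_integrand_nonneg hF hB hg hu ht p
  linarith

/-! ## §3 Strictness: a composed genuine bond is a genuine bond -/

/-- **Two sets of positive mass, one below the other, make the reference measure see two comparable
points**: if `μ A ≠ 0`, `μ C ≠ 0` and every point of `A` lies below every point of `C`, then
`0 < (μ ⊗ μ) {(x, y) | x < y}`. [ours] -/
theorem prod_lt_pos_of_separated [SFinite μ] {A C : Set X} (hA : μ A ≠ 0) (hC : μ C ≠ 0)
    (hAC : ∀ x ∈ A, ∀ y ∈ C, x < y) : 0 < (μ.prod μ) {p : X × X | p.1 < p.2} := by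
  have hsub : A ×ˢ C ⊆ {p : X × X | p.1 < p.2} := fun p hp => hAC p.1 hp.1 p.2 hp.2
  refine lt_of_lt_of_le ?_ (measure_mono hsub)
  rw [Measure.prod_prod]
  exact ENNReal.mul_pos hA hC

/-- **STRICT TP₂ ∘ STRICT TP₂ IS STRICT TP₂** when the reference measure sees two comparable points.
`F`, `B` strictly TP₂ (`F(u,y)F(u',x) < F(u,x)F(u',y)` for `u < u'`, `x < y`), `g > 0`, the sections
integrable, `0 < (μ ⊗ μ){x < y}`: then `K(u,t')K(u',t) < K(u,t)K(u',t')` for `u < u'`, `t < t'`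
(the integrand of the composition formula is `≥ 0` and `> 0` on `{x < y}`).
[folklore: Karlin; typed here] -/
theorem compKernel_stp2 [SFinite μ] {F B : X → X → ℝ} {g : X → ℝ}
    (hF : ∀ u u' x y, u < u' → x < y → F u y * F u' x < F u x * F u' y)
    (hB : ∀ x y t t', x < y → t < t' → B x t' * B y t < B x t * B y t')
    (hg : ∀ x, 0 < g x) (hint : ∀ v r, Integrable (fun x => F v x * g x * B x r) μ)
    (hμ : 0 < (μ.prod μ) {p : X × X | p.1 < p.2}) {u u' t t' : X} (hu : u < u') (ht : t < t') :
    compKernel μ F g B u t' * compKernel μ F g B u' t <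
      compKernel μ F g B u t * compKernel μ F g B u' t' := by
  have h := compKernel_minor_eq μ F g B u u' t t' hint
  -- the integrand, non-negative everywhere and positive on `{x < y}`
  let I : X × X → ℝ := fun p => (F u p.1 * F u' p.2 - F u p.2 * F u' p.1) * (g p.1 * g p.2) *
    (B p.1 t * B p.2 t' - B p.1 t' * B p.2 t)
  have hInn : 0 ≤ I := fun p =>
    minor_integrand_nonneg (fun u u' x y hu hxy => (hF u u' x y hu hxy).le)
      (fun x y t t' hxy htt => (hB x y t t' hxy htt).le) (fun x => (hg x).le) hu ht p
  have hIi : Integrable I (μ.prod μ) := integrable_minor_integrand μ F g B u u' t t' hint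
  have hsupp : {p : X × X | p.1 < p.2} ⊆ support I := by
    intro p hp
    have h1 : 0 < F u p.1 * F u' p.2 - F u p.2 * F u' p.1 := sub_pos.2 (hF u u' p.1 p.2 hu hp)
    have h2 : 0 < g p.1 * g p.2 := mul_pos (hg _) (hg _)
    have h3 : 0 < B p.1 t * B p.2 t' - B p.1 t' * B p.2 t := sub_pos.2 (hB p.1 p.2 t t' hp ht)
    exact (mul_pos (mul_pos h1 h2) h3).ne'
  have hpos : 0 < ∫ p, I p ∂(μ.prod μ) := by
    rw [integral_pos_iff_support_of_nonneg hInn hIi]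
    exact lt_of_lt_of_le hμ (measure_mono hsupp)
  have hI : (∫ p : X × X, (F u p.1 * F u' p.2 - F u p.2 * F u' p.1) * (g p.1 * g p.2) *
      (B p.1 t * B p.2 t' - B p.1 t' * B p.2 t) ∂(μ.prod μ)) = ∫ p, I p ∂(μ.prod μ) := rfl
  rw [hI] at h
  linarith

/-- If the reference measure sees two comparable points, there ARE two comparable points. [ours] -/
theorem exists_lt_of_prod_lt_pos {ν : Measure (X × X)} (hν : 0 < ν {p : X × X | p.1 < p.2}) :
    ∃ x y : X, x < y := by
  by_contra h
  have : {p : X × X | p.1 < p.2} = ∅ := Set.eq_empty_of_forall_notMem fun p hp => h ⟨p.1, p.2, hp⟩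
  rw [this, measure_empty] at hν
  exact lt_irrefl _ hν

/-- **A COMPOSED GENUINE BOND IS A GENUINE BOND**: under the hypotheses of `compKernel_stp2` the
composed kernel is NOT of product form — `K(u,t)K(u',t') ≠ K(u,t')K(u',t)` for some values. [ours] -/
theorem compKernel_not_productForm [SFinite μ] {F B : X → X → ℝ} {g : X → ℝ}
    (hF : ∀ u u' x y, u < u' → x < y → F u y * F u' x < F u x * F u' y)
    (hB : ∀ x y t t', x < y → t < t' → B x t' * B y t < B x t * B y t')
    (hg : ∀ x, 0 < g x) (hint : ∀ v r, Integrable (fun x => F v x * g x * B x r) μ)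
    (hμ : 0 < (μ.prod μ) {p : X × X | p.1 < p.2}) :
    ∃ u u' t t' : X, compKernel μ F g B u t * compKernel μ F g B u' t' ≠
      compKernel μ F g B u t' * compKernel μ F g B u' t := by
  obtain ⟨x, y, hxy⟩ := exists_lt_of_prod_lt_pos hμ
  exact ⟨x, y, x, y, (compKernel_stp2 μ hF hB hg hint hμ hxy hxy).ne'⟩

end Order

/-! ## §4 What is carried along a path: positivity, bounds, measurability; iterated composition -/

/-- A bounded measurable section against a finite measure is integrable (bookkeeping). [ours] -/
theorem integrable_section [IsFiniteMeasure μ] {F B : X → X → ℝ} {g : X → ℝ}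
    (hFm : Measurable (uncurry F)) (hgm : Measurable g) (hBm : Measurable (uncurry B))
    {CF Cg CB : ℝ} (hFb : ∀ u x, |F u x| ≤ CF) (hgb : ∀ x, |g x| ≤ Cg) (hBb : ∀ x t, |B x t| ≤ CB)
    (v r : X) : Integrable (fun x => F v x * g x * B x r) μ := by
  have hm : Measurable fun x => F v x * g x * B x r :=
    ((hFm.comp (measurable_const.prodMk measurable_id)).mul hgm).mul
      (hBm.comp (measurable_id.prodMk measurable_const))
  refine Integrable.mono' (integrable_const (CF * Cg * CB)) hm.aestronglyMeasurable
    (ae_of_all _ fun x => ?_)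
  rw [Real.norm_eq_abs, abs_mul, abs_mul]
  have h0 : 0 ≤ CF := le_trans (abs_nonneg _) (hFb v x)
  have h1 : 0 ≤ Cg := le_trans (abs_nonneg _) (hgb x)
  exact mul_le_mul (mul_le_mul (hFb v x) (hgb x) (abs_nonneg _) h0) (hBb x r) (abs_nonneg _)
    (mul_nonneg h0 h1)

/-- The composed kernel is jointly measurable (Fubini measurability of a parametric integral).
[ours] -/
theorem measurable_compKernel [SFinite μ] {F B : X → X → ℝ} {g : X → ℝ}
    (hFm : Measurable (uncurry F)) (hgm : Measurable g) (hBm : Measurable (uncurry B)) :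
    Measurable (uncurry (compKernel μ F g B)) := by
  have hh : Measurable fun q : (X × X) × X => F q.1.1 q.2 * g q.2 * B q.2 q.1.2 :=
    ((hFm.comp ((measurable_fst.comp measurable_fst).prodMk measurable_snd)).mul
      (hgm.comp measurable_snd)).mul
      (hBm.comp (measurable_snd.prodMk (measurable_snd.comp measurable_fst)))
  have hsm := (hh.stronglyMeasurable).integral_prod_right' (ν := μ)
  have heq : (fun p : X × X => ∫ x, F p.1 x * g x * B x p.2 ∂μ) = uncurry (compKernel μ F g B) := by
    funext p; rfl
  rw [← heq]
  exact hsm.measurable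

/-- The composed kernel of bounded data against a finite measure is bounded:
`|K(u,t)| ≤ C_F C_g C_B · μ(X)`. [ours] -/
theorem abs_compKernel_le [IsFiniteMeasure μ] {F B : X → X → ℝ} {g : X → ℝ} {CF Cg CB : ℝ}
    (hFb : ∀ u x, |F u x| ≤ CF) (hgb : ∀ x, |g x| ≤ Cg) (hBb : ∀ x t, |B x t| ≤ CB) (u t : X) :
    |compKernel μ F g B u t| ≤ CF * Cg * CB * μ.real univ := by
  rw [compKernel_apply]
  have h0 : 0 ≤ CF := le_trans (abs_nonneg _) (hFb u u)
  have h1 : 0 ≤ Cg := le_trans (abs_nonneg _) (hgb u)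
  have hpt : ∀ x, ‖F u x * g x * B x t‖ ≤ CF * Cg * CB := by
    intro x
    rw [Real.norm_eq_abs, abs_mul, abs_mul]
    exact mul_le_mul (mul_le_mul (hFb u x) (hgb x) (abs_nonneg _) h0) (hBb x t) (abs_nonneg _)
      (mul_nonneg h0 h1)
  calc |∫ x, F u x * g x * B x t ∂μ| = ‖∫ x, F u x * g x * B x t ∂μ‖ := (Real.norm_eq_abs _).symm
    _ ≤ CF * Cg * CB * μ.real univ := norm_integral_le_of_norm_le_const (ae_of_all _ hpt)

/-- The composed kernel of positive measurable bounded data is positive, provided `μ ≠ 0`. [ours] -/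
theorem compKernel_pos [IsFiniteMeasure μ] {F B : X → X → ℝ} {g : X → ℝ}
    (hFp : ∀ u x, 0 < F u x) (hgp : ∀ x, 0 < g x) (hBp : ∀ x t, 0 < B x t)
    (hFm : Measurable (uncurry F)) (hgm : Measurable g) (hBm : Measurable (uncurry B))
    {CF Cg CB : ℝ} (hFb : ∀ u x, |F u x| ≤ CF) (hgb : ∀ x, |g x| ≤ Cg) (hBb : ∀ x t, |B x t| ≤ CB)
    (hμ : μ univ ≠ 0) (u t : X) : 0 < compKernel μ F g B u t := by
  rw [compKernel_apply, integral_pos_iff_support_of_nonneg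
    (fun x => (mul_pos (mul_pos (hFp u x) (hgp x)) (hBp x t)).le)
    (integrable_section μ hFm hgm hBm hFb hgb hBb u t)]
  have : support (fun x => F u x * g x * B x t) = univ :=
    Set.eq_univ_of_forall fun x => (mul_pos (mul_pos (hFp u x) (hgp x)) (hBp x t)).ne'
  rw [this]
  exact pos_iff_ne_zero.2 hμ

/-- **Iterated composition along a path**: starting from the bond `F` out of the current variable,
compose successively through the integrated sites with site weights `g_i` and onward bonds `b_i`:
`pathKernel μ F [(g₁,b₁), …, (g_k,b_k)] = ((F ∘_{g₁} b₁) ∘_{g₂} b₂) ⋯ ∘_{g_k} b_k`. [ours] -/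
def pathKernel (μ : Measure X) : (X → X → ℝ) → List ((X → ℝ) × (X → X → ℝ)) → X → X → ℝ
  | F, [] => F
  | F, gb :: rest => pathKernel μ (compKernel μ F gb.1 gb.2) rest

/-- `pathKernel` on the empty path is the bond itself. [ours] -/
@[simp] theorem pathKernel_nil (F : X → X → ℝ) : pathKernel μ F [] = F := rfl
/-- `pathKernel` through one more site. [ours] -/
@[simp] theorem pathKernel_cons (F : X → X → ℝ) (gb : (X → ℝ) × (X → X → ℝ))
    (rest : List ((X → ℝ) × (X → X → ℝ))) :
    pathKernel μ F (gb :: rest) = pathKernel μ (compKernel μ F gb.1 gb.2) rest := rfl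

section PathOrder

variable [LinearOrder X]

/-- **ALONG ANY FINITE PATH OF STRICTLY TP₂ BONDS THE COMPOSED KERNEL IS STRICTLY TP₂** (and positive,
bounded, jointly measurable): `μ` a finite measure seeing two comparable points; the initial bond `F`
and every onward bond `b_i` strictly TP₂, positive, bounded, jointly measurable; every site weight
`g_i` positive, bounded, measurable.  Induction on the path with `compKernel_stp2`. [ours] -/
theorem pathKernel_stp2 [IsFiniteMeasure μ] (hμ : 0 < (μ.prod μ) {p : X × X | p.1 < p.2})
    (path : List ((X → ℝ) × (X → X → ℝ)))
    (hg : ∀ gb ∈ path, (∀ x, 0 < gb.1 x) ∧ Measurable gb.1 ∧ ∃ C, ∀ x, |gb.1 x| ≤ C)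
    (hb : ∀ gb ∈ path, (∀ x t, 0 < gb.2 x t) ∧ Measurable (uncurry gb.2) ∧
      (∃ C, ∀ x t, |gb.2 x t| ≤ C) ∧
      ∀ x y t t', x < y → t < t' → gb.2 x t' * gb.2 y t < gb.2 x t * gb.2 y t') :
    ∀ F : X → X → ℝ, (∀ u x, 0 < F u x) → Measurable (uncurry F) → (∃ C, ∀ u x, |F u x| ≤ C) →
      (∀ u u' x y, u < u' → x < y → F u y * F u' x < F u x * F u' y) →
      (∀ u x, 0 < pathKernel μ F path u x) ∧ Measurable (uncurry (pathKernel μ F path)) ∧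
        (∃ C, ∀ u x, |pathKernel μ F path u x| ≤ C) ∧
        ∀ u u' x y, u < u' → x < y →
          pathKernel μ F path u y * pathKernel μ F path u' x <
            pathKernel μ F path u x * pathKernel μ F path u' y := by
  have hμ0 : μ univ ≠ 0 := by
    intro h0
    have : μ.prod μ = 0 := by rw [Measure.measure_univ_eq_zero.1 h0, Measure.prod_zero]
    rw [this] at hμ
    exact lt_irrefl _ hμ
  induction path with
  | nil =>
    intro F hFp hFm hFb hFs
    exact ⟨hFp, hFm, hFb, hFs⟩
  | cons gb rest ih =>
    intro F hFp hFm hFb hFs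
    obtain ⟨hgp, hgm, Cg, hgb⟩ := hg gb (by simp)
    obtain ⟨hbp, hbm, ⟨CB, hbb⟩, hbs⟩ := hb gb (by simp)
    obtain ⟨CF, hFb⟩ := hFb
    rw [pathKernel_cons]
    refine ih (fun gb' h => hg gb' (by simp [h])) (fun gb' h => hb gb' (by simp [h]))
      (compKernel μ F gb.1 gb.2) ?_ ?_ ?_ ?_
    · exact compKernel_pos μ hFp hgp hbp hFm hgm hbm hFb hgb hbb hμ0
    · exact measurable_compKernel μ hFm hgm hbm
    · exact ⟨_, abs_compKernel_le μ hFb hgb hbb⟩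
    · intro u u' x y hu hxy
      exact compKernel_stp2 μ hFs hbs hgp (integrable_section μ hFm hgm hbm hFb hgb hbb) hμ hu hxy

/-- **Hence the composed kernel along a path is not of product form.** [ours] -/
theorem pathKernel_not_productForm [IsFiniteMeasure μ] (hμ : 0 < (μ.prod μ) {p : X × X | p.1 < p.2})
    (path : List ((X → ℝ) × (X → X → ℝ)))
    (hg : ∀ gb ∈ path, (∀ x, 0 < gb.1 x) ∧ Measurable gb.1 ∧ ∃ C, ∀ x, |gb.1 x| ≤ C)
    (hb : ∀ gb ∈ path, (∀ x t, 0 < gb.2 x t) ∧ Measurable (uncurry gb.2) ∧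
      (∃ C, ∀ x t, |gb.2 x t| ≤ C) ∧
      ∀ x y t t', x < y → t < t' → gb.2 x t' * gb.2 y t < gb.2 x t * gb.2 y t')
    {F : X → X → ℝ} (hFp : ∀ u x, 0 < F u x) (hFm : Measurable (uncurry F))
    (hFb : ∃ C, ∀ u x, |F u x| ≤ C)
    (hFs : ∀ u u' x y, u < u' → x < y → F u y * F u' x < F u x * F u' y) :
    ∃ u u' t t' : X, pathKernel μ F path u t * pathKernel μ F path u' t' ≠
      pathKernel μ F path u t' * pathKernel μ F path u' t := by
  obtain ⟨x, y, hxy⟩ := exists_lt_of_prod_lt_pos hμ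
  obtain ⟨-, -, -, hs⟩ := pathKernel_stp2 μ hμ path hg hb F hFp hFm hFb hFs
  exact ⟨x, y, x, y, (hs x y x y hxy hxy).ne'⟩

end PathOrder

/-! ## §5 Traversing a bond backwards; reference measures on `ℝ` -/

/-- TP₂ is symmetric under exchanging the roles of the two arguments: the flipped kernel
`(x, u) ↦ F(u, x)` is strictly TP₂ iff `F` is (a bond can be traversed in either direction). [ours] -/
theorem stp2_flip {Y : Type*} [LinearOrder Y] {F : Y → Y → ℝ}
    (hF : ∀ u u' x y, u < u' → x < y → F u y * F u' x < F u x * F u' y)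
    (x x' u u' : Y) (hx : x < x') (hu : u < u') :
    flip F x u' * flip F x' u < flip F x u * flip F x' u' := by
  simp only [flip]; linarith [hF u u' x x' hu hx]

/-- On `ℝ`, a reference measure charging two separated half-lines sees two comparable points; e.g.
any measure with `μ(−∞, c) ≠ 0` and `μ(c, ∞) ≠ 0`. [ours] -/
theorem real_prod_lt_pos (ν : Measure ℝ) [SFinite ν] (c : ℝ) (h₁ : ν (Iio c) ≠ 0)
    (h₂ : ν (Ioi c) ≠ 0) : 0 < (ν.prod ν) {p : ℝ × ℝ | p.1 < p.2} :=
  prod_lt_pos_of_separated ν h₁ h₂ fun _ hx _ hy => lt_trans hx hy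

end Summit.Ventures.LatticeQCDFlow.Theory2.Autoregressive

end
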